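import Summits.Ventures.DiscreteObjects.PP12.FlagSevenOrbitDataOfPlane
import Summits.Ventures.DiscreteObjects.PP12.FlagTenConjunctR2

/-!
# The `f = 7` flag-cell orbit matrix: the columns ARE the non-trivial point orbits (kernel; Step C₁ of the FlagSevenOrbitReduction roadmap)
Framing: lottery ticket; floor = certified bounds/negative ranges.

Cell pub-namedobj (venture DiscreteObjects), target (M), designs gen 14. Setting as in `FlagSevenOrbitDataOfPlane` (order 12, flag type, `σ³ = 1`,
`f = 7`, non-fixed c-lines `u₀, u₁` with `u₁ ∉ orb3 u₀`). The typed statement `IsFlagSevenOrbitMatrix` (p327216) sums over the index types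
`F7Col = Fin 2 ⊕ (Fin 2 × Fin 12) ⊕ (Fin 6 × Fin 4)` and `F7Row` (same shape); this file identifies them with the orbits of the plane:
* `colOrbit` — column `c` ↦ its point orbit (`Z_t`, the triangle `orb3 x_{s,i}`, the T-point orbit `(j,t)` on `m_j`); every value is a
  non-trivial point orbit (`colOrbit_mem_orbits3`), the map is injective (`colOrbit_injective`) and reaches every non-trivial point orbit
  (`exists_colOrbit_eq`) — so `Σ_{c : F7Col}` is `Σ_{S ∈ orbits3 σ}` (`OrbitSideIdentities.orbit_row_identity_orbits`);
* the rows (`rowOrbit`, representative lines `lineRep`) are treated in `FlagSevenRowOrbits`.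
Remaining (Steps C₂, D): the entries `entry r c = |colOrbit c ∩ (a line of rowOrbit r)|`, the shape conjuncts, and the transport of the orbit
identities. No `sorry`, no new axioms.
-/

namespace Summit.Ventures.DiscreteObjects.PP12

open Configuration Finset
open scoped Classical

namespace Collineation

variable {P L : Type*} [Membership P L] [ProjectivePlane P L] [Fintype P] [Fintype L] (σ : Collineation P L)

section Flag

variable {l : L} {c : P} (hl : σ.onLines l = l) (hc : σ.onPoints c = c) (hcl : c ∈ l)
  (hP : ∀ p : P, σ.onPoints p = p → p ∈ l) (hL : ∀ m : L, σ.onLines m = m → c ∈ m)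
  (h12 : ProjectivePlane.order P L = 12)

omit [ProjectivePlane P L] [Fintype L] in
include hl in
/-- Points of an orbit of a non-fixed point of `l` lie on `l` and are not fixed. -/
theorem zOrbit_sub {S : Finset P} (hS : S ∈ (univ.filter fun p : P => p ∈ l ∧ σ.onPoints p ≠ p).image (orb3 σ.onPoints))
    {p : P} (hp : p ∈ S) : p ∈ l ∧ σ.onPoints p ≠ p := by
  obtain ⟨z, hz, rfl⟩ := mem_image.1 hS
  rw [mem_filter] at hz
  exact ⟨σ.mem_fixedLine_of_mem_orb3 hl hz.2.1 hp, σ.not_fixed_of_mem_orb3 hz.2.2 hp⟩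

omit [Fintype L] in
include hc hcl hP hL in
/-- Points of an orbit of points `≠ c` of a fixed line `m ≠ l` lie on `m` and are not fixed (in particular `≠ c`). -/
theorem orbOn_sub {m : L} (hm : σ.onLines m = m) (hml : m ≠ l) {S : Finset P}
    (hS : S ∈ (univ.filter fun p : P => p ∈ m ∧ p ≠ c).image (orb3 σ.onPoints)) {p : P} (hp : p ∈ S) :
    p ∈ m ∧ p ≠ c ∧ σ.onPoints p ≠ p := by
  obtain ⟨w, hw, rfl⟩ := mem_image.1 hS
  rw [mem_filter] at hw
  have hwf : σ.onPoints w ≠ w := fun e => hw.2.2 ((Nondegenerate.eq_or_eq hw.2.1 (hL m hm) (hP w e) hcl).resolve_right hml)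
  have hpf : σ.onPoints p ≠ p := σ.not_fixed_of_mem_orb3 hwf hp
  exact ⟨σ.mem_fixedLine_of_mem_orb3 hm hw.2.1 hp, fun e => hpf (by rw [e, hc]), hpf⟩

section Data

variable (hl : σ.onLines l = l) (hc : σ.onPoints c = c) (hcl : c ∈ l)
  (hP : ∀ p : P, σ.onPoints p = p → p ∈ l) (hL : ∀ m : L, σ.onLines m = m → c ∈ m) (h12 : ProjectivePlane.order P L = 12)
  (hq : σ.onPoints ^ 3 = 1) (hf : fixedCard σ.onPoints = 7) {u₀ u₁ : L} (hcu₀ : c ∈ u₀) (hu₀ : σ.onLines u₀ ≠ u₀)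
  (hcu₁ : c ∈ u₁) (hu₁ : σ.onLines u₁ ≠ u₁)

/-- **The point orbit of a column** of the `f = 7` orbit matrix. -/
noncomputable def colOrbit : F7Col → Finset P
  | Sum.inl t => (σ.eZ hl hP h12 hq hf t).1
  | Sum.inr (Sum.inl (s, i)) => orb3 σ.onPoints (σ.eTri7 h12 hcu₀ hu₀ hcu₁ hu₁ s i).1
  | Sum.inr (Sum.inr (j, t)) => (σ.eOrbOn hc hcl hP hL h12 hq (σ.eFixL6 hl hc hf j) t).1

/-! ### Columns -/

/-- Every column orbit is a non-trivial point orbit. -/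
theorem colOrbit_mem_orbits3 (c₀ : F7Col) : σ.colOrbit hl hc hcl hP hL h12 hq hf hcu₀ hu₀ hcu₁ hu₁ c₀ ∈ σ.orbits3 := by
  unfold orbits3
  rcases c₀ with t | ⟨s, i⟩ | ⟨j, t⟩
  · obtain ⟨z, hz, hzeq⟩ := mem_image.1 (σ.eZ hl hP h12 hq hf t).2
    rw [mem_filter] at hz
    exact mem_image.2 ⟨z, mem_filter.2 ⟨mem_univ _, hz.2.2⟩, hzeq⟩
  · have hxX := σ.exterior_of_triIdx s (σ.eTri7 h12 hcu₀ hu₀ hcu₁ hu₁ s i) hcu₀ hu₀ hcu₁ hu₁ hL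
    exact mem_image.2 ⟨_, mem_filter.2 ⟨mem_univ _, σ.not_fixed_of_exterior_flag hl hP hxX⟩, rfl⟩
  · set m := σ.eFixL6 hl hc hf j with hm
    obtain ⟨w, hw, hweq⟩ := mem_image.1 (σ.eOrbOn hc hcl hP hL h12 hq m t).2
    rw [mem_filter] at hw
    have hwf : σ.onPoints w ≠ w := fun e => hw.2.2 ((Nondegenerate.eq_or_eq hw.2.1 (hL m.1 m.2.1) (hP w e) hcl).resolve_right m.2.2)
    exact mem_image.2 ⟨w, mem_filter.2 ⟨mem_univ _, hwf⟩, hweq⟩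

/-- **The column indexing is injective** (`u₁ ∉ orb3 u₀`). -/
theorem colOrbit_injective (h01 : u₁ ∉ orb3 σ.onLines u₀) :
    Function.Injective (σ.colOrbit hl hc hcl hP hL h12 hq hf hcu₀ hu₀ hcu₁ hu₁) := by
  intro c₁ c₂ h
  -- helper facts about the three kinds of orbits
  have zfacts : ∀ t : Fin 2, ∀ p ∈ (σ.eZ hl hP h12 hq hf t).1, p ∈ l ∧ σ.onPoints p ≠ p :=
    fun t p hp => σ.zOrbit_sub hl (σ.eZ hl hP h12 hq hf t).2 hp
  have trifacts : ∀ (s : Fin 2) (i : Fin 12), ∀ p ∈ orb3 σ.onPoints (σ.eTri7 h12 hcu₀ hu₀ hcu₁ hu₁ s i).1,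
      ∀ m : L, σ.onLines m = m → p ∉ m :=
    fun s i p hp => σ.exterior_of_mem_orb3 (σ.exterior_of_triIdx s (σ.eTri7 h12 hcu₀ hu₀ hcu₁ hu₁ s i) hcu₀ hu₀ hcu₁ hu₁ hL) hp
  have tfacts : ∀ (j : Fin 6) (t : Fin 4), ∀ p ∈ (σ.eOrbOn hc hcl hP hL h12 hq (σ.eFixL6 hl hc hf j) t).1,
      p ∈ (σ.eFixL6 hl hc hf j).1 ∧ p ≠ c ∧ σ.onPoints p ≠ p :=
    fun j t p hp => σ.orbOn_sub hc hcl hP hL (σ.eFixL6 hl hc hf j).2.1 (σ.eFixL6 hl hc hf j).2.2 (σ.eOrbOn hc hcl hP hL h12 hq _ t).2 hp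
  have zne : ∀ t : Fin 2, ((σ.eZ hl hP h12 hq hf t).1 : Finset P).Nonempty := fun t => by
    obtain ⟨z, -, hzeq⟩ := mem_image.1 (σ.eZ hl hP h12 hq hf t).2
    exact ⟨z, by rw [← hzeq]; exact self_mem_orb3 _ _⟩
  have tne : ∀ (j : Fin 6) (t : Fin 4), ((σ.eOrbOn hc hcl hP hL h12 hq (σ.eFixL6 hl hc hf j) t).1 : Finset P).Nonempty := fun j t => by
    obtain ⟨w, -, hweq⟩ := mem_image.1 (σ.eOrbOn hc hcl hP hL h12 hq (σ.eFixL6 hl hc hf j) t).2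
    exact ⟨w, by rw [← hweq]; exact self_mem_orb3 _ _⟩
  rcases c₁ with t | ⟨s, i⟩ | ⟨j, t⟩ <;> rcases c₂ with t' | ⟨s', i'⟩ | ⟨j', t'⟩ <;>
    simp only [colOrbit] at h
  · -- Z / Z
    exact congrArg Sum.inl ((σ.eZ hl hP h12 hq hf).injective (Subtype.ext h))
  · -- Z / tri: a point of l versus an exterior orbit
    exfalso
    obtain ⟨p, hp⟩ := zne t
    have h1 := (zfacts t p hp).1
    rw [h] at hp
    exact trifacts s' i' p hp l hl h1
  · -- Z / tpt: on l versus on m_j, meeting only in c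
    exfalso
    obtain ⟨p, hp⟩ := zne t
    have h1 := (zfacts t p hp).1
    rw [h] at hp
    obtain ⟨hpm, hpc, -⟩ := tfacts j' t' p hp
    exact hpc ((Nondegenerate.eq_or_eq hpm (hL _ (σ.eFixL6 hl hc hf j').2.1) h1 hcl).resolve_right (σ.eFixL6 hl hc hf j').2.2)
  · exfalso
    obtain ⟨p, hp⟩ := zne t'
    have h1 := (zfacts t' p hp).1
    rw [← h] at hp
    exact trifacts s i p hp l hl h1
  · -- tri / tri
    set x := σ.eTri7 h12 hcu₀ hu₀ hcu₁ hu₁ s i with hx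
    set x' := σ.eTri7 h12 hcu₀ hu₀ hcu₁ hu₁ s' i' with hx'
    have hx'x : x'.1 ∈ orb3 σ.onPoints x.1 := by rw [h]; exact self_mem_orb3 _ _
    by_cases hss : s = s'
    · subst hss
      have heq : x'.1 = x.1 := σ.vertex_eq_of_mem_orb3 hc hq (σ.cl_spec hcu₀ hu₀ hcu₁ hu₁ s).1 (σ.cl_spec hcu₀ hu₀ hcu₁ hu₁ s).2 x'.2.1 x.2.1 hx'x
      have : i' = i := (σ.eTri7 h12 hcu₀ hu₀ hcu₁ hu₁ s).injective (Subtype.ext heq)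
      rw [this]
    · exfalso
      -- vertices of one triangle on both u₀ and u₁
      have key : ∀ {a b : Fin 2}, a ≠ b → ∀ (xa : TriIdx (P := P) c (cl u₀ u₁ a)) (xb : TriIdx (P := P) c (cl u₀ u₁ b)),
          xb.1 ∈ orb3 σ.onPoints xa.1 → False := by
        intro a b hab xa xb hmem
        fin_cases a <;> fin_cases b
        · exact hab rfl
        · exact σ.not_both_classes hc hq hcu₀ hu₀ hcu₁ h01 (self_mem_orb3 _ xa.1) xa.2.1 xa.2.2 hmem xb.2.1
        · exact σ.not_both_classes hc hq hcu₀ hu₀ hcu₁ h01 hmem xb.2.1 xb.2.2 (self_mem_orb3 _ xa.1) xa.2.1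
        · exact hab rfl
      exact key hss x x' hx'x
  · -- tri / tpt
    exfalso
    obtain ⟨p, hp⟩ := tne j' t'
    obtain ⟨hpm, -, -⟩ := tfacts j' t' p hp
    rw [← h] at hp
    exact trifacts s i p hp _ (σ.eFixL6 hl hc hf j').2.1 hpm
  · exfalso
    obtain ⟨p, hp⟩ := zne t'
    have h1 := (zfacts t' p hp).1
    rw [← h] at hp
    obtain ⟨hpm, hpc, -⟩ := tfacts j t p hp
    exact hpc ((Nondegenerate.eq_or_eq hpm (hL _ (σ.eFixL6 hl hc hf j).2.1) h1 hcl).resolve_right (σ.eFixL6 hl hc hf j).2.2)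
  · exfalso
    obtain ⟨p, hp⟩ := tne j t
    obtain ⟨hpm, -, -⟩ := tfacts j t p hp
    rw [h] at hp
    exact trifacts s' i' p hp _ (σ.eFixL6 hl hc hf j).2.1 hpm
  · -- tpt / tpt
    obtain ⟨p, hp⟩ := tne j t
    obtain ⟨hpm, hpc, -⟩ := tfacts j t p hp
    have hp' := hp; rw [h] at hp'
    obtain ⟨hpm', -, -⟩ := tfacts j' t' p hp'
    have hjj : j = j' := by
      by_contra hne
      have hmm : (σ.eFixL6 hl hc hf j).1 ≠ (σ.eFixL6 hl hc hf j').1 := fun e => hne ((σ.eFixL6 hl hc hf).injective (Subtype.ext e))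
      exact hpc ((Nondegenerate.eq_or_eq hpm (hL _ (σ.eFixL6 hl hc hf j).2.1) hpm' (hL _ (σ.eFixL6 hl hc hf j').2.1)).resolve_right hmm)
    subst hjj
    have : t = t' := (σ.eOrbOn hc hcl hP hL h12 hq (σ.eFixL6 hl hc hf j)).injective (Subtype.ext h)
    rw [this]

/-- **The column indexing is surjective** onto the non-trivial point orbits (`f = 7`). -/
theorem exists_colOrbit_eq (h01 : u₁ ∉ orb3 σ.onLines u₀) {S : Finset P} (hS : S ∈ σ.orbits3) :
    ∃ c₀ : F7Col, σ.colOrbit hl hc hcl hP hL h12 hq hf hcu₀ hu₀ hcu₁ hu₁ c₀ = S := by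
  unfold orbits3 at hS
  obtain ⟨p, hp, rfl⟩ := mem_image.1 hS
  rw [mem_filter] at hp
  obtain ⟨-, hpf⟩ := hp
  by_cases hpl : p ∈ l
  · -- a Z-orbit
    have hmem : orb3 σ.onPoints p ∈ (univ.filter fun q : P => q ∈ l ∧ σ.onPoints q ≠ q).image (orb3 σ.onPoints) :=
      σ.lpointOrbit_mem hpl hpf
    refine ⟨Sum.inl ((σ.eZ hl hP h12 hq hf).symm ⟨_, hmem⟩), ?_⟩
    simp only [colOrbit, Equiv.apply_symm_apply]
  · by_cases hfix : ∃ m : L, σ.onLines m = m ∧ p ∈ m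
    · -- a T-point orbit on m ≠ l
      obtain ⟨m, hm, hpm⟩ := hfix
      have hml : m ≠ l := fun e => hpl (e ▸ hpm)
      have hpc : p ≠ c := fun e => hpf (by rw [e, hc])
      have hmem : orb3 σ.onPoints p ∈ (univ.filter fun q : P => q ∈ m ∧ q ≠ c).image (orb3 σ.onPoints) :=
        mem_image.2 ⟨p, mem_filter.2 ⟨mem_univ _, hpm, hpc⟩, rfl⟩
      set j := (σ.eFixL6 hl hc hf).symm ⟨m, hm, hml⟩ with hj
      have hmj : (σ.eFixL6 hl hc hf j) = ⟨m, hm, hml⟩ := by rw [hj, Equiv.apply_symm_apply]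
      refine ⟨Sum.inr (Sum.inr (j, (σ.eOrbOn hc hcl hP hL h12 hq (σ.eFixL6 hl hc hf j)).symm ⟨_, by rw [hmj]; exact hmem⟩)), ?_⟩
      simp only [colOrbit, Equiv.apply_symm_apply]
    · -- an exterior orbit: a vertex on u₀ or u₁
      push Not at hfix
      have hpX : ∀ m : L, σ.onLines m = m → p ∉ m := fun m hm hpm => hfix m hm hpm
      rcases σ.exterior_orbit_meets_clines hl hc hcl hL h12 hq hf hcu₀ hu₀ hcu₁ hu₁ h01 hpX with ⟨x, hxp, hxu⟩ | ⟨x, hxp, hxu⟩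
      · have hxX := σ.exterior_of_mem_orb3 hpX hxp
        have hxc : x ≠ c := fun e => hxX l hl (e ▸ hcl)
        have hxu' : x ∈ cl u₀ u₁ 0 := by simp only [cl]; exact hxu
        refine ⟨Sum.inr (Sum.inl (0, (σ.eTri7 h12 hcu₀ hu₀ hcu₁ hu₁ 0).symm ⟨x, hxu', hxc⟩)), ?_⟩
        simp only [colOrbit, Equiv.apply_symm_apply]
        exact orb3_eq_of_mem σ.onPoints hq hxp
      · have hxX := σ.exterior_of_mem_orb3 hpX hxp
        have hxc : x ≠ c := fun e => hxX l hl (e ▸ hcl)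
        have hxu' : x ∈ cl u₀ u₁ 1 := by simp only [cl]; exact hxu
        refine ⟨Sum.inr (Sum.inl (1, (σ.eTri7 h12 hcu₀ hu₀ hcu₁ hu₁ 1).symm ⟨x, hxu', hxc⟩)), ?_⟩
        simp only [colOrbit, Equiv.apply_symm_apply]
        exact orb3_eq_of_mem σ.onPoints hq hxp

end Data

end Flag

end Collineation

end Summit.Ventures.DiscreteObjects.PP12
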